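import Literature.AlgebraicGeometry.Deformation.InvertibleSheafExtensions
import Literature.AlgebraicGeometry.Modules.LinearOverBase
import HarnessLib

/-!
# Multiplication by a global function on the ideal `𝓘` of a thickening, as an endomorphism of the abelian sheaf

Layer `Literature/AlgebraicGeometry/Deformation`, namespace `Literature.AlgebraicGeometry.Deformation`.  THEOREMS ONLY (no
definition, no named fact, no instance, no notation, no `sorry`).

For a morphism of schemes `i : X ⟶ X'` the tree's ideal `𝓘 = ker (i♯ : 𝒪_{X'} → i_*𝒪_X)` is an `𝒪_{X'}`-MODULE (★
`Deformation.idealModule i`, a kernel in `X'.Modules`), and `Deformation.idealSheafAb i` is its underlying abelian sheaf (so that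
Mathlib's `Sheaf.H` applies).  Multiplication by a GLOBAL FUNCTION `s ∈ Γ(X', 𝒪_{X'})` is therefore an honest endomorphism of
`𝓘`: the ★ homothety `Modules.globalScalar (idealModule i) s` ([GortzWedhorn2020] (7.3.6)) read through the forgetful functor
`SheafOfModules.toSheaf` (the tree's `HodgeTheory.modulesToSheaf`).  This file records that endomorphism's SECTIONWISE VALUE
`idealVal (s · x) = s|_V · idealVal x` and packages it as the existence statement which the scalar clauses of the (Mc) N3′ tower
quantify over («for every endomorphism `μ` of `𝓘` acting sectionwise as multiplication by `s` …» — B-p03 (g20) S-c1, B-p19 (g18)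
(S3″b), B-p07 (g20) #3 §4): such a `μ` EXISTS for every `s`, and it is UNIQUE.

* `idealVal_globalScalar_app` — `idealVal i V ((s·) x) = s|_V * idealVal i V x`;
* `exists_idealSheafAb_hom_mul` — `∃ μ : idealSheafAb i ⟶ idealSheafAb i` acting sectionwise as multiplication by `s`;
* `idealSheafAb_hom_ext_of_idealVal` — an endomorphism of `𝓘` is determined by its sectionwise values (`idealVal` is injective),
  whence `eq_map_globalScalar_of_idealVal` (any such `μ` IS the homothety) and the consequences `Sheaf.H.map μ n` additive ∕
  multiplicative ∕ unital in `s` (`map_H_add_of_idealVal`, `map_H_mul_of_idealVal`, `map_H_one_of_idealVal`).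

Cell `hodgecm-mathlib` (D-0151), F-3 (M) grandchild line `Cruxes/HDel/Lines/F3DualAbelianSchemeMc`, N3′ tower, brick K4 (target-space
panel of the S-e count; wave-1 prover F0P1c-p05 (g0)).  HC_CM is proved only modulo the 7 printed citations until rung 0 closes;
nothing here is about HC.

## References
* [GortzWedhorn2020] U. Görtz, T. Wedhorn, *Algebraic Geometry I* (2nd ed. 2020), §(7.3), (7.3.6) (the `Γ(X, 𝒪_X)`-module structure).
* [StacksProject] The Stacks Project, Tag 08KY (thickenings; the ideal `𝓘 = ker(𝒪_{X'} → i_*𝒪_X)`).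
* [Hartshorne2010] R. Hartshorne, *Deformation Theory* (2010), §6 (6.1) p. 46 («`J` can be considered as a `k`-vector space») and
  proof of Thm. 6.4 (pp. 50–51).
-/

set_option autoImplicit false

noncomputable section

universe u

open CategoryTheory Opposite TopologicalSpace AlgebraicGeometry

namespace Literature.AlgebraicGeometry.Deformation

open Literature.AlgebraicGeometry.Modules

variable {X X' : Scheme.{u}} (i : X ⟶ X')

/-! ## §1 The homothety of `𝓘` by a global function and its sectionwise value -/

/-- **Sectionwise value of the homothety** `s· : 𝓘 → 𝓘` (★ `Modules.globalScalar (idealModule i) s`): for a section `x` of `𝓘`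
over `V`, `idealVal (s · x) = s|_V * idealVal x` in `Γ(X', V)` — the inclusion `𝓘 ↪ 𝒪_{X'}` is `𝒪_{X'}`-linear (★
`Modules.globalScalar_comp`) and on `𝒪_{X'}` the homothety is multiplication. [cite: GortzWedhorn2020, Section (7.3) eq. (7.3.6)] -/
theorem idealVal_globalScalar_app (s : Γ(X', ⊤)) (V : X'.Opens) (x : (idealSheafAb i).obj.obj (op V)) :
    idealVal i V ((globalScalar (idealModule i) s).app V x) =
      X'.presheaf.map (homOfLE (le_top : V ≤ ⊤)).op s * idealVal i V x := by
  have h := congrArg (fun φ => φ.app V x) (globalScalar_comp (idealModuleι i) s)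
  dsimp only at h
  rw [Scheme.Modules.Hom.comp_app, Scheme.Modules.Hom.comp_app, CategoryTheory.comp_apply, CategoryTheory.comp_apply,
    globalScalar_app_apply] at h
  exact h

/-- **Multiplication by a global function is an endomorphism of the abelian sheaf `𝓘`**: for every `s ∈ Γ(X', 𝒪_{X'})` there is
`μ : idealSheafAb i ⟶ idealSheafAb i` with `idealVal (μ x) = s|_V * idealVal x` for all sections `x` of `𝓘` over all opens `V`
(namely the ★ homothety `globalScalar (idealModule i) s` under `SheafOfModules.toSheaf`).  This is the `μ` over which the scalar
clauses of the (Mc) N3′ tower quantify. [cite: GortzWedhorn2020, Section (7.3) eq. (7.3.6)] [cite: StacksProject, Tag 08KY] -/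
theorem exists_idealSheafAb_hom_mul (s : Γ(X', ⊤)) :
    ∃ μ : idealSheafAb i ⟶ idealSheafAb i, ∀ (V : X'.Opens) (x : (idealSheafAb i).obj.obj (op V)),
      idealVal i V (μ.hom.app (op V) x) = X'.presheaf.map (homOfLE (le_top : V ≤ ⊤)).op s * idealVal i V x :=
  ⟨(HodgeTheory.modulesToSheaf X').map (globalScalar (idealModule i) s), fun V x => idealVal_globalScalar_app i s V x⟩

/-! ## §2 Uniqueness: an endomorphism of `𝓘` is determined by its sectionwise values -/

/-- **Two endomorphisms of the abelian sheaf `𝓘` with the same sectionwise values are equal** (`idealVal` is injective on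
sections, ★ `idealVal_injective`; morphisms of sheaves are determined by their components). [cite: StacksProject, Tag 08KY] -/
theorem idealSheafAb_hom_ext_of_idealVal (μ μ' : idealSheafAb i ⟶ idealSheafAb i)
    (h : ∀ (V : X'.Opens) (x : (idealSheafAb i).obj.obj (op V)),
      idealVal i V (μ.hom.app (op V) x) = idealVal i V (μ'.hom.app (op V) x)) : μ = μ' := by
  ext V x
  exact idealVal_injective i V.unop (h V.unop x)

/-- **Any endomorphism of `𝓘` acting sectionwise as multiplication by `s` IS the homothety by `s`.**
[cite: GortzWedhorn2020, Section (7.3) eq. (7.3.6)] -/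
theorem eq_map_globalScalar_of_idealVal (s : Γ(X', ⊤)) (μ : idealSheafAb i ⟶ idealSheafAb i)
    (hμ : ∀ (V : X'.Opens) (x : (idealSheafAb i).obj.obj (op V)),
      idealVal i V (μ.hom.app (op V) x) = X'.presheaf.map (homOfLE (le_top : V ≤ ⊤)).op s * idealVal i V x) :
    μ = (HodgeTheory.modulesToSheaf X').map (globalScalar (idealModule i) s) :=
  idealSheafAb_hom_ext_of_idealVal i _ _ fun V x => (hμ V x).trans (idealVal_globalScalar_app i s V x).symm

/-- **Additivity in the function**: if `μ₁`, `μ₂`, `μ` act sectionwise as multiplication by `s₁`, `s₂`, `s₁ + s₂`, then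
`μ = μ₁ + μ₂`, hence `Hⁿ(μ) = Hⁿ(μ₁) + Hⁿ(μ₂)` on `Hⁿ(X', 𝓘)`. [cite: GortzWedhorn2020, Section (7.3) eq. (7.3.6)] -/
theorem map_H_add_of_idealVal (s₁ s₂ : Γ(X', ⊤)) (μ₁ μ₂ μ : idealSheafAb i ⟶ idealSheafAb i)
    (h₁ : ∀ (V : X'.Opens) (x : (idealSheafAb i).obj.obj (op V)),
      idealVal i V (μ₁.hom.app (op V) x) = X'.presheaf.map (homOfLE (le_top : V ≤ ⊤)).op s₁ * idealVal i V x)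
    (h₂ : ∀ (V : X'.Opens) (x : (idealSheafAb i).obj.obj (op V)),
      idealVal i V (μ₂.hom.app (op V) x) = X'.presheaf.map (homOfLE (le_top : V ≤ ⊤)).op s₂ * idealVal i V x)
    (h : ∀ (V : X'.Opens) (x : (idealSheafAb i).obj.obj (op V)),
      idealVal i V (μ.hom.app (op V) x) = X'.presheaf.map (homOfLE (le_top : V ≤ ⊤)).op (s₁ + s₂) * idealVal i V x)
    (n : ℕ) (t : (idealSheafAb i).H n) :
    Sheaf.H.map μ n t = Sheaf.H.map μ₁ n t + Sheaf.H.map μ₂ n t := by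
  have hμ : μ = μ₁ + μ₂ := by
    refine idealSheafAb_hom_ext_of_idealVal i _ _ fun V x => ?_
    have e : (μ₁ + μ₂).hom.app (op V) x = μ₁.hom.app (op V) x + μ₂.hom.app (op V) x := rfl
    rw [e, idealVal_add, h V x, h₁ V x, h₂ V x, map_add, add_mul]
  rw [hμ, Sheaf.H.map_add_apply]

/-- **Multiplicativity in the function**: if `μ₁`, `μ₂`, `μ` act sectionwise as multiplication by `s₁`, `s₂`, `s₁ * s₂`, then
`μ = μ₂ ≫ μ₁`, hence `Hⁿ(μ) = Hⁿ(μ₁) ∘ Hⁿ(μ₂)`. [cite: GortzWedhorn2020, Section (7.3) eq. (7.3.6)] -/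
theorem map_H_mul_of_idealVal (s₁ s₂ : Γ(X', ⊤)) (μ₁ μ₂ μ : idealSheafAb i ⟶ idealSheafAb i)
    (h₁ : ∀ (V : X'.Opens) (x : (idealSheafAb i).obj.obj (op V)),
      idealVal i V (μ₁.hom.app (op V) x) = X'.presheaf.map (homOfLE (le_top : V ≤ ⊤)).op s₁ * idealVal i V x)
    (h₂ : ∀ (V : X'.Opens) (x : (idealSheafAb i).obj.obj (op V)),
      idealVal i V (μ₂.hom.app (op V) x) = X'.presheaf.map (homOfLE (le_top : V ≤ ⊤)).op s₂ * idealVal i V x)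
    (h : ∀ (V : X'.Opens) (x : (idealSheafAb i).obj.obj (op V)),
      idealVal i V (μ.hom.app (op V) x) = X'.presheaf.map (homOfLE (le_top : V ≤ ⊤)).op (s₁ * s₂) * idealVal i V x)
    (n : ℕ) (t : (idealSheafAb i).H n) :
    Sheaf.H.map μ n t = Sheaf.H.map μ₁ n (Sheaf.H.map μ₂ n t) := by
  have hμ : μ = μ₂ ≫ μ₁ := by
    refine idealSheafAb_hom_ext_of_idealVal i _ _ fun V x => ?_
    have e : (μ₂ ≫ μ₁).hom.app (op V) x = μ₁.hom.app (op V) (μ₂.hom.app (op V) x) := rfl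
    rw [e, h V x, h₁ V (μ₂.hom.app (op V) x), h₂ V x, map_mul, mul_assoc]
  rw [hμ, Sheaf.H.map_comp_apply]

/-- **Unitality**: an endomorphism of `𝓘` acting sectionwise as multiplication by `1` is the identity, hence acts as the identity
on `Hⁿ(X', 𝓘)`. [cite: GortzWedhorn2020, Section (7.3) eq. (7.3.6)] -/
theorem map_H_one_of_idealVal (μ : idealSheafAb i ⟶ idealSheafAb i)
    (h : ∀ (V : X'.Opens) (x : (idealSheafAb i).obj.obj (op V)),
      idealVal i V (μ.hom.app (op V) x) = X'.presheaf.map (homOfLE (le_top : V ≤ ⊤)).op 1 * idealVal i V x)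
    (n : ℕ) (t : (idealSheafAb i).H n) : Sheaf.H.map μ n t = t := by
  have hμ : μ = 𝟙 _ := by
    refine idealSheafAb_hom_ext_of_idealVal i _ _ fun V x => ?_
    have e : (𝟙 (idealSheafAb i) : idealSheafAb i ⟶ idealSheafAb i).hom.app (op V) x = x := rfl
    rw [e, h V x, map_one, one_mul]
  rw [hμ, Sheaf.H.map_id_apply]

end Literature.AlgebraicGeometry.Deformation

end
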